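/-
Copyright (c) 2026 the pub-hodgecm-mathlib formalisation cell (harness21).  Prover seat hodgecm-mathlib-B-p14 (g35): road «S3-tree» (LEAD F0P3a-plan (g11); architect A-p16 (g28∕g29);
acting architect F0P3-p01 (g16)), brick T1d′ «discharging `htr₂`», FILE 2 = THE HYPERBOLIC PAIR IN THE `ϖ`-MODULAR PLANE OF A TYPE-TWO VERTEX; 2026-09-01.
-/
import Literature.NumberTheory.Automorphic.UnitaryLatticeTreeTypeTwoGram   -- ★ T1d′ FILE 1 (B-p14 (g35)): `exists_orthogonal_basis`, `typeTwo_block`, `vertexTriple_of_latt_eq`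
import HarnessLib

/-!
# The lattice graph of a hermitian space — XII: an exactly HYPERBOLIC PAIR in the `ϖ`-modular plane of a type-two vertex (the isotropy of `J₀` forces residual isotropy;
# exact isotropy by the norm equation of ★ `UnramifiedLocalConjDatum.exists_isotropic_coeff`) (Jacobowitz 1962 §4, §7; O'Meara §82F)

Topic `NumberTheory/Automorphic`; namespace `Literature.NumberTheory.Automorphic.UnitaryLatticeTree`.  THEOREMS ONLY (no definition, no instance, no notation, no named fact,
no `sorry`); kernel lane.  Cell `pub/hodgecm-mathlib` (D-0151), crux H413 = `stmt-HodgeConjecture-24833`; road «S3-tree», brick **T1d′** (discharge of `htr₂`), FILE 2 of 3.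
HONEST LABEL: HC_CM is proved only modulo the 2 remaining named inputs (hLiu418 24832, h413 24833) until rung 0 closes; nothing printed is asserted here.

THE MATHEMATICS.  `M = latt g` a type-two vertex of `(K³, J₀)` in an orthogonal basis `x = g e₀, c₁ = g e₁, c₂ = g e₂` of FILE 1 (`|h(x,x)| = 1`, `x ⊥ c₁, c₂`, `h(cₐ, c_b) ∈ ϖ𝒪`,
`|h(c₁,c₁)h(c₂,c₂) − h(c₁,c₂)h(c₂,c₁)| = |ϖ|²`).  (§33) `ℤᵐ⁰` helpers and a scaling lemma.  (§34) RESIDUAL ISOTROPY FROM THE ISOTROPY OF `J₀`: write the isotropic vector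
`e₀ = w₀x + n`, `n = w₁c₁ + w₂c₂`; then `h(n,n) = −N(w₀)h(x,x)` has EVEN valuation, so after scaling `n` to a primitive vector `n₀ = βc₁ + γc₂` of `N′ = 𝒪c₁ + 𝒪c₂`
(`max(|β|,|γ|) = 1`) the value `h(n₀,n₀) ∈ ϖ𝒪` has even valuation, hence lies in `ϖ²𝒪`; unimodularity of `ϖ⁻¹h` on `N′` gives a partner `n₁ ∈ N′` with `h(n₀,n₁) = ϖ`
(`exists_near_hyperbolic_pair`).  (§35) EXACT ISOTROPY (any rank `N`, any `𝒪`-module `M ∋ n₀, n₁`): `f₀ = n₀ + αn₁` with `c + α + σα + qασ(α) = 0`, `c = h(n₀,n₀)∕ϖ ∈ 𝔪`,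
`q = h(n₁,n₁)∕ϖ` (★ `exists_isotropic_coeff`), then `f₂ = w⁻¹n₁ − t·(h(w⁻¹n₁,w⁻¹n₁)∕ϖ)·f₀` (`t + σt = 1`): `h(f₀,f₀) = h(f₂,f₂) = 0`, `h(f₀,f₂) = ϖ`, both `⊥ x`
(`exists_hyperbolic_pair_of_near_pair`); together **`exists_hyperbolic_pair_orthogonal`**.

## References
* [Jacobowitz1962] R. Jacobowitz, *Hermitian forms over local fields*, Amer. J. Math. 84 (1962), §4, §7.
* [Omeara1963] O. T. O'Meara, *Introduction to Quadratic Forms* (1963), §82F (82:17), §93.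
* [Serre1979] J.-P. Serre, *Local Fields*, GTM 67 (1979), Ch. V §2 Prop. 3.
-/

set_option autoImplicit false

noncomputable section

open scoped Valued WithZero Matrix MatrixGroups

namespace Literature.NumberTheory.Automorphic.UnitaryLatticeTree

open Literature.NumberTheory.Automorphic Literature.NumberTheory.Automorphic.HermitianLattice
open Literature.NumberTheory.Automorphic.CartanUnique

variable {K : Type*} [Field K] [Valued K ℤᵐ⁰] {σ : K →+* K} {ϖ : K} {N : ℕ}

/-! ## §33 Helpers in the value group `ℤᵐ⁰`; scaling a pair to a primitive pair -/

omit [Field K] [Valued K ℤᵐ⁰] in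
/-- A square `≤ exp(−1)` in `ℤᵐ⁰` is `≤ exp(−2)` (squares have even exponent). [cite: Omeara1963, Ch. I §16] -/
theorem mul_self_le_exp_neg_two {a : ℤᵐ⁰} (h : a * a ≤ WithZero.exp (-1 : ℤ)) : a * a ≤ WithZero.exp (-2 : ℤ) := by
  by_cases ha : a = 0
  · rw [ha, mul_zero]; exact zero_le
  · rw [← WithZero.exp_log ha, ← WithZero.exp_add, WithZero.exp_le_exp] at h ⊢
    omega

omit [Field K] [Valued K ℤᵐ⁰] in
/-- `a·a = 1 ⇒ a = 1` in `ℤᵐ⁰`. [cite: Omeara1963, Ch. I §16] -/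
theorem eq_one_of_mul_self_eq_one {a : ℤᵐ⁰} (h : a * a = 1) : a = 1 := by
  by_cases ha : a = 0
  · rw [ha, mul_zero] at h; exact absurd h zero_ne_one
  · rw [← WithZero.exp_log ha, ← WithZero.exp_add, ← WithZero.exp_zero, WithZero.exp_inj] at h
    rw [← WithZero.exp_log ha, ← WithZero.exp_zero]
    congr 1; omega

/-- **Scaling a non-zero pair to a primitive pair**: for `(w₁, w₂) ≠ 0` some `ϖ^k·(w₁, w₂)` is integral with a unit coordinate. [cite: Omeara1963, §81D] -/
theorem exists_zpow_mul_primitive (hϖ : Valued.v ϖ = WithZero.exp (-1 : ℤ)) {w₁ w₂ : K} (h : w₁ ≠ 0 ∨ w₂ ≠ 0) :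
    ∃ k : ℤ, Valued.v (ϖ ^ k * w₁) ≤ 1 ∧ Valued.v (ϖ ^ k * w₂) ≤ 1 ∧ (Valued.v (ϖ ^ k * w₁) = 1 ∨ Valued.v (ϖ ^ k * w₂) = 1) := by
  -- the coordinate of larger valuation
  have key : ∀ {a b : K}, Valued.v a ≤ Valued.v b → b ≠ 0 → ∃ k : ℤ, Valued.v (ϖ ^ k * a) ≤ 1 ∧ Valued.v (ϖ ^ k * b) = 1 := by
    intro a b hab hb
    have hvb : Valued.v b ≠ 0 := (Valuation.ne_zero_iff _).2 hb
    set L : ℤ := WithZero.log (Valued.v b) with hL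
    have hb' : Valued.v b = WithZero.exp L := (WithZero.exp_log hvb).symm
    refine ⟨L, ?_, ?_⟩
    · rw [map_mul, v_uniformizer_zpow hϖ]
      calc WithZero.exp (-L) * Valued.v a ≤ WithZero.exp (-L) * Valued.v b := mul_le_mul_right hab _
        _ = 1 := by rw [hb', ← WithZero.exp_add, neg_add_cancel, WithZero.exp_zero]
    · rw [map_mul, v_uniformizer_zpow hϖ, hb', ← WithZero.exp_add, neg_add_cancel, WithZero.exp_zero]
  rcases le_total (Valued.v w₁) (Valued.v w₂) with hle | hle
  · have hw₂ : w₂ ≠ 0 := by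
      rintro rfl
      rw [map_zero, le_zero_iff, map_eq_zero] at hle
      exact h.elim (fun h1 => h1 hle) (fun h2 => h2 rfl)
    obtain ⟨k, h1, h2⟩ := key hle hw₂
    exact ⟨k, h1, h2.le, Or.inr h2⟩
  · have hw₁ : w₁ ≠ 0 := by
      rintro rfl
      rw [map_zero, le_zero_iff, map_eq_zero] at hle
      exact h.elim (fun h1 => h1 rfl) (fun h2 => h2 hle)
    obtain ⟨k, h1, h2⟩ := key hle hw₁
    exact ⟨k, h2.le, h1, Or.inl h2⟩

omit [Valued K ℤᵐ⁰] in
/-- Coordinates in a basis: `v = w₀·g e₀ + w₁·g e₁ + w₂·g e₂` with `w = g⁻¹v`. [cite: Omeara1963, §81A] -/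
theorem eq_coords_three (g : GL (Fin 3) K) (v : Fin 3 → K) :
    v = (((g⁻¹ : GL (Fin 3) K) : Matrix (Fin 3) (Fin 3) K).mulVec v) 0 • (g : Matrix (Fin 3) (Fin 3) K).mulVec (Pi.single 0 1) +
      ((((g⁻¹ : GL (Fin 3) K) : Matrix (Fin 3) (Fin 3) K).mulVec v) 1 • (g : Matrix (Fin 3) (Fin 3) K).mulVec (Pi.single 1 1) +
        (((g⁻¹ : GL (Fin 3) K) : Matrix (Fin 3) (Fin 3) K).mulVec v) 2 • (g : Matrix (Fin 3) (Fin 3) K).mulVec (Pi.single 2 1)) := by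
  set w : Fin 3 → K := ((g⁻¹ : GL (Fin 3) K) : Matrix (Fin 3) (Fin 3) K).mulVec v with hw
  have hgw : (g : Matrix (Fin 3) (Fin 3) K).mulVec w = v := by
    rw [hw, Matrix.mulVec_mulVec, ← Units.val_mul, mul_inv_cancel, Units.val_one, Matrix.one_mulVec]
  have hw3 : w = w 0 • (Pi.single 0 1 : Fin 3 → K) + (w 1 • Pi.single 1 1 + w 2 • Pi.single 2 1) := by
    funext i; fin_cases i <;> simp
  calc v = (g : Matrix (Fin 3) (Fin 3) K).mulVec w := hgw.symm
    _ = (g : Matrix (Fin 3) (Fin 3) K).mulVec (w 0 • (Pi.single 0 1 : Fin 3 → K) + (w 1 • Pi.single 1 1 + w 2 • Pi.single 2 1)) := by rw [← hw3]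
    _ = _ := by rw [Matrix.mulVec_add, Matrix.mulVec_add, Matrix.mulVec_smul, Matrix.mulVec_smul, Matrix.mulVec_smul]

/-! ## §34 Residual isotropy of the `ϖ`-modular plane from an isotropic vector; a near-hyperbolic pair -/

/-- **A NEAR-HYPERBOLIC PAIR IN THE `ϖ`-MODULAR PLANE** (vector form, any rank).  `M` an `𝒪`-module of vectors, `x, c₁, c₂` with `|h(x,x)| = 1`, `x ⊥ c₁, c₂ ∈ M`, `h(cₐ,c_b) ∈ ϖ𝒪`,
`|h(c₁,c₁)h(c₂,c₂) − h(c₁,c₂)h(c₂,c₁)| = |ϖ|²`, and an ISOTROPIC `e = w₀x + w₁c₁ + w₂c₂ ≠ 0`.  Then there are `n₀, n₁ ∈ M`, orthogonal to `x`, with `|h(n₀,n₀)| ≤ |ϖ|²`,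
`h(n₀,n₁) = ϖ`, `|h(n₁,n₁)| ≤ |ϖ|` (`h(n,n) = −N(w₀)h(x,x)` for `n = w₁c₁ + w₂c₂` has even valuation; scale `n` to a primitive `n₀`; `h(n₀,n₀) ∈ ϖ𝒪` of even valuation lies in `ϖ²𝒪`;
the row `(σβ,σγ)·ϖ⁻¹G₁` of a primitive `(β,γ)` is primitive, giving the partner). [cite: Jacobowitz1962, §4, §7] [cite: Omeara1963, §82F] -/
theorem exists_near_hyperbolic_pair (hd : UnramifiedLocalConjDatum σ ϖ) (M : Submodule 𝒪[K] (Fin N → K)) {x c₁ c₂ e : Fin N → K} {w₀ w₁ w₂ : K}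
    (hc₁ : c₁ ∈ M) (hc₂ : c₂ ∈ M) (hx : Valued.v (B₀ σ N x x) = 1) (h01 : B₀ σ N x c₁ = 0) (h02 : B₀ σ N x c₂ = 0)
    (hG11 : Valued.v (B₀ σ N c₁ c₁) ≤ Valued.v ϖ) (hG12 : Valued.v (B₀ σ N c₁ c₂) ≤ Valued.v ϖ) (hG21 : Valued.v (B₀ σ N c₂ c₁) ≤ Valued.v ϖ)
    (hG22 : Valued.v (B₀ σ N c₂ c₂) ≤ Valued.v ϖ) (hdet : Valued.v (B₀ σ N c₁ c₁ * B₀ σ N c₂ c₂ - B₀ σ N c₁ c₂ * B₀ σ N c₂ c₁) = Valued.v ϖ ^ 2)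
    (he : B₀ σ N e e = 0) (he0 : e ≠ 0) (hew : e = w₀ • x + (w₁ • c₁ + w₂ • c₂)) :
    ∃ n₀ n₁ : Fin N → K, n₀ ∈ M ∧ n₁ ∈ M ∧ B₀ σ N x n₀ = 0 ∧ B₀ σ N x n₁ = 0 ∧
      Valued.v (B₀ σ N n₀ n₀) ≤ Valued.v ϖ ^ 2 ∧ B₀ σ N n₀ n₁ = ϖ ∧ Valued.v (B₀ σ N n₁ n₁) ≤ Valued.v ϖ := by
  have hϖ0 : ϖ ≠ 0 := uniformizer_ne_zero hd.vϖ
  have hvϖ0 : Valued.v ϖ ≠ 0 := (Valuation.ne_zero_iff Valued.v).2 hϖ0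
  set ε : K := B₀ σ N x x with hε
  have hε0 : ε ≠ 0 := fun h => by rw [h, map_zero] at hx; exact zero_ne_one hx
  have herm : ∀ y z : Fin N → K, B₀ σ N z y = σ (B₀ σ N y z) := fun y z => (isHermitianForm_B₀ hd.σσ y z).symm
  -- integral combinations of `c₁, c₂` lie in `M`, are orthogonal to `x`, and have `h`-length in `ϖ𝒪`
  have hmem : ∀ {β γ : K}, Valued.v β ≤ 1 → Valued.v γ ≤ 1 → β • c₁ + γ • c₂ ∈ M := fun hβ hγ =>
    M.add_mem (smul_mem_of_v_le _ hβ hc₁) (smul_mem_of_v_le _ hγ hc₂)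
  have horth : ∀ β γ : K, B₀ σ N x (β • c₁ + γ • c₂) = 0 := fun β γ => by
    rw [map_add, form_smul_right, form_smul_right, h01, h02, mul_zero, mul_zero, add_zero]
  have hlen : ∀ {β γ : K}, Valued.v β ≤ 1 → Valued.v γ ≤ 1 → Valued.v (B₀ σ N (β • c₁ + γ • c₂) (β • c₁ + γ • c₂)) ≤ Valued.v ϖ := by
    intro β γ hβ hγ
    have hexp : B₀ σ N (β • c₁ + γ • c₂) (β • c₁ + γ • c₂) =
        σ β * (β * B₀ σ N c₁ c₁ + γ * B₀ σ N c₁ c₂) + σ γ * (β * B₀ σ N c₂ c₁ + γ * B₀ σ N c₂ c₂) := by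
      simp only [map_add, LinearMap.add_apply, form_smul_left, form_smul_right]; ring
    rw [hexp]
    have hb : ∀ {a b b' u u' : K}, Valued.v a ≤ 1 → Valued.v b ≤ 1 → Valued.v b' ≤ 1 → Valued.v u ≤ Valued.v ϖ → Valued.v u' ≤ Valued.v ϖ →
        Valued.v (σ a * (b * u + b' * u')) ≤ Valued.v ϖ := by
      intro a b b' u u' ha hb hb' hu hu'
      rw [map_mul, hd.vσ]
      refine le_trans (mul_le_of_le_one_left' ha) (Valuation.map_add_le _ ?_ ?_)
      · rw [map_mul]; exact le_trans (mul_le_of_le_one_left' hb) hu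
      · rw [map_mul]; exact le_trans (mul_le_of_le_one_left' hb') hu'
    exact Valuation.map_add_le _ (hb hβ hβ hγ hG11 hG12) (hb hγ hβ hγ hG21 hG22)
  -- the plane part `n` of the isotropic vector
  set n : Fin N → K := w₁ • c₁ + w₂ • c₂ with hn
  have hxn : B₀ σ N x n = 0 := horth _ _
  have hnx : B₀ σ N n x = 0 := by rw [herm, hxn, map_zero]
  have hnn : B₀ σ N n n = -(σ w₀ * w₀ * ε) := by
    have h := he
    rw [hew] at h
    simp only [map_add, LinearMap.add_apply, form_smul_left, form_smul_right, hxn, hnx, mul_zero, add_zero, zero_add] at h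
    rw [← hε] at h
    linear_combination h
  -- `(w₁, w₂) ≠ 0`
  have hw12 : w₁ ≠ 0 ∨ w₂ ≠ 0 := by
    by_contra hcon
    push Not at hcon
    have hn0 : n = 0 := by rw [hn, hcon.1, hcon.2, zero_smul, zero_smul, add_zero]
    have hw0 : w₀ = 0 := by
      have h := hnn
      simp only [hn0, map_zero] at h
      have h' : σ w₀ * w₀ * ε = 0 := by linear_combination h
      rcases mul_eq_zero.1 h' with h'' | h''
      · rcases mul_eq_zero.1 h'' with h3 | h3
        · exact (map_eq_zero σ).1 h3
        · exact h3
      · exact absurd h'' hε0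
    exact he0 (by rw [hew, hn0, hw0, zero_smul, zero_add])
  -- scale to a primitive pair
  obtain ⟨k, hβ, hγ, hprim⟩ := exists_zpow_mul_primitive hd.vϖ hw12
  set β : K := ϖ ^ k * w₁ with hβdef
  set γ : K := ϖ ^ k * w₂ with hγdef
  set n₀ : Fin N → K := β • c₁ + γ • c₂ with hn₀
  have hn₀n : n₀ = (ϖ ^ k) • n := by rw [hn₀, hn, smul_add, smul_smul, smul_smul]
  have hσk : σ (ϖ ^ k) = ϖ ^ k := by rw [map_zpow₀, hd.σϖ]
  -- `|h(n₀,n₀)| ≤ |ϖ|²`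
  have hn₀n₀ : Valued.v (B₀ σ N n₀ n₀) ≤ Valued.v ϖ ^ 2 := by
    have hsq : Valued.v (B₀ σ N n₀ n₀) = Valued.v (ϖ ^ k * w₀) * Valued.v (ϖ ^ k * w₀) := by
      rw [hn₀n, form_smul_left, form_smul_right, hσk, hnn]
      simp only [map_mul, Valuation.map_neg, hd.vσ, hx, one_mul, mul_comm, mul_assoc, mul_left_comm]
    have h1 : Valued.v (B₀ σ N n₀ n₀) ≤ WithZero.exp (-1 : ℤ) := by rw [← hd.vϖ]; exact hlen hβ hγ
    rw [hsq] at h1 ⊢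
    rw [hd.vϖ, ← WithZero.exp_nsmul]
    exact mul_self_le_exp_neg_two h1
  -- the partner: the row `(σβ, σγ)·(ϖ⁻¹G₁)` is primitive
  set u₁₁ : K := B₀ σ N c₁ c₁ / ϖ with hu₁₁
  set u₁₂ : K := B₀ σ N c₁ c₂ / ϖ with hu₁₂
  set u₂₁ : K := B₀ σ N c₂ c₁ / ϖ with hu₂₁
  set u₂₂ : K := B₀ σ N c₂ c₂ / ϖ with hu₂₂
  have hu : ∀ {a : K}, Valued.v a ≤ Valued.v ϖ → Valued.v (a / ϖ) ≤ 1 := fun ha => by rw [map_div₀]; exact div_le_one_of_le₀ ha zero_le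
  have hδ : Valued.v (u₁₁ * u₂₂ - u₁₂ * u₂₁) = 1 := by
    have h : u₁₁ * u₂₂ - u₁₂ * u₂₁ = (B₀ σ N c₁ c₁ * B₀ σ N c₂ c₂ - B₀ σ N c₁ c₂ * B₀ σ N c₂ c₁) / ϖ ^ 2 := by
      rw [hu₁₁, hu₁₂, hu₂₁, hu₂₂]; field_simp
    rw [h, map_div₀, map_pow, hdet, div_self (pow_ne_zero 2 hvϖ0)]
  set r₁ : K := σ β * u₁₁ + σ γ * u₂₁ with hr₁
  set r₂ : K := σ β * u₁₂ + σ γ * u₂₂ with hr₂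
  have hr₁e : B₀ σ N n₀ c₁ = ϖ * r₁ := by
    rw [hn₀, map_add, LinearMap.add_apply, form_smul_left, form_smul_left, hr₁, hu₁₁, hu₂₁]; field_simp
  have hr₂e : B₀ σ N n₀ c₂ = ϖ * r₂ := by
    rw [hn₀, map_add, LinearMap.add_apply, form_smul_left, form_smul_left, hr₂, hu₁₂, hu₂₂]; field_simp
  have hr₁v : Valued.v r₁ ≤ 1 := by
    refine Valuation.map_add_le _ ?_ ?_
    · rw [map_mul, hd.vσ]; exact mul_le_one' hβ (hu hG11)
    · rw [map_mul, hd.vσ]; exact mul_le_one' hγ (hu hG21)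
  have hr₂v : Valued.v r₂ ≤ 1 := by
    refine Valuation.map_add_le _ ?_ ?_
    · rw [map_mul, hd.vσ]; exact mul_le_one' hβ (hu hG12)
    · rw [map_mul, hd.vσ]; exact mul_le_one' hγ (hu hG22)
  -- Cramer: `σβ·δ = r₁u₂₂ − r₂u₂₁`, `σγ·δ = r₂u₁₁ − r₁u₁₂`
  have hcr₁ : σ β * (u₁₁ * u₂₂ - u₁₂ * u₂₁) = r₁ * u₂₂ - r₂ * u₂₁ := by rw [hr₁, hr₂]; ring
  have hcr₂ : σ γ * (u₁₁ * u₂₂ - u₁₂ * u₂₁) = r₂ * u₁₁ - r₁ * u₁₂ := by rw [hr₁, hr₂]; ring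
  have hunit : Valued.v r₁ = 1 ∨ Valued.v r₂ = 1 := by
    by_contra hcon
    push Not at hcon
    have h1 : Valued.v r₁ < 1 := lt_of_le_of_ne hr₁v hcon.1
    have h2 : Valued.v r₂ < 1 := lt_of_le_of_ne hr₂v hcon.2
    have hsmall : ∀ {r r' u u' : K}, Valued.v r < 1 → Valued.v r' < 1 → Valued.v u ≤ 1 → Valued.v u' ≤ 1 → Valued.v (r * u - r' * u') < 1 := by
      intro r r' u u' hr hr' hu hu'
      refine Valuation.map_sub_lt _ ?_ ?_
      · rw [map_mul]; exact mul_lt_one_of_lt_of_le hr hu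
      · rw [map_mul]; exact mul_lt_one_of_lt_of_le hr' hu'
    have hβ1 : Valued.v β < 1 := by
      have h := hsmall h1 h2 (hu hG22) (hu hG21)
      rwa [← hcr₁, map_mul, hd.vσ, hδ, mul_one] at h
    have hγ1 : Valued.v γ < 1 := by
      have h := hsmall h2 h1 (hu hG11) (hu hG12)
      rwa [← hcr₂, map_mul, hd.vσ, hδ, mul_one] at h
    rcases hprim with h | h
    · exact absurd h hβ1.ne
    · exact absurd h hγ1.ne
  -- assemble the partner `n₁ = r_b⁻¹ · c_b`
  have hpartner : ∀ {r : K} {c : Fin N → K}, Valued.v r = 1 → c ∈ M → B₀ σ N x c = 0 → B₀ σ N n₀ c = ϖ * r → Valued.v (B₀ σ N c c) ≤ Valued.v ϖ →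
      ∃ n₁ : Fin N → K, n₁ ∈ M ∧ B₀ σ N x n₁ = 0 ∧ B₀ σ N n₀ n₁ = ϖ ∧ Valued.v (B₀ σ N n₁ n₁) ≤ Valued.v ϖ := by
    intro r c hrv hc hxc hn₀c hcc
    have hr0 : r ≠ 0 := fun h => by rw [h, map_zero] at hrv; exact zero_ne_one hrv
    refine ⟨r⁻¹ • c, smul_mem_of_v_le _ (by rw [map_inv₀, hrv, inv_one]) hc, by rw [form_smul_right, hxc, mul_zero], ?_, ?_⟩
    · rw [form_smul_right, hn₀c, ← mul_assoc, mul_comm r⁻¹, mul_assoc, inv_mul_cancel₀ hr0, mul_one]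
    · rw [form_smul_left, form_smul_right, map_mul, map_mul, hd.vσ, map_inv₀, hrv, inv_one, one_mul, one_mul]; exact hcc
  have hn₀mem : n₀ ∈ M := hmem hβ hγ
  have hxn₀ : B₀ σ N x n₀ = 0 := horth β γ
  rcases hunit with h | h
  · obtain ⟨n₁, hn₁, hxn₁, h₀₁, h₁₁⟩ := hpartner h hc₁ h01 hr₁e hG11
    exact ⟨n₀, n₁, hn₀mem, hn₁, hxn₀, hxn₁, hn₀n₀, h₀₁, h₁₁⟩
  · obtain ⟨n₁, hn₁, hxn₁, h₀₁, h₁₁⟩ := hpartner h hc₂ h02 hr₂e hG22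
    exact ⟨n₀, n₁, hn₀mem, hn₁, hxn₀, hxn₁, hn₀n₀, h₀₁, h₁₁⟩

/-! ## §35 Exact isotropy: a hyperbolic pair from a near-hyperbolic pair (any rank) -/

/-- **A HYPERBOLIC PAIR FROM A NEAR-HYPERBOLIC PAIR** (any rank `N`, unramified datum).  If `n₀, n₁ ∈ M` are orthogonal to `x` with `|h(n₀,n₀)| ≤ |ϖ|²`, `h(n₀,n₁) = ϖ`,
`|h(n₁,n₁)| ≤ |ϖ|`, then there are `f₀, f₂ ∈ M`, orthogonal to `x`, with `h(f₀,f₀) = h(f₂,f₂) = 0` and `h(f₀,f₂) = ϖ`: `f₀ = n₀ + αn₁` where `c + α + σα + qασ(α) = 0`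
(`c = h(n₀,n₀)∕ϖ ∈ 𝔪`, `q = h(n₁,n₁)∕ϖ`; ★ `UnramifiedLocalConjDatum.exists_isotropic_coeff`, a NORM equation), and `f₂ = g₂ − t·(h(g₂,g₂)∕ϖ)·f₀` with `g₂ = h(f₀,n₁)⁻¹ϖ·n₁`,
`t + σt = 1`. [cite: Jacobowitz1962, §7] [cite: Omeara1963, §82F] [cite: Serre1979, Ch. V §2 Prop. 3] -/
theorem exists_hyperbolic_pair_of_near_pair (hd : UnramifiedLocalConjDatum σ ϖ) (M : Submodule 𝒪[K] (Fin N → K)) {x n₀ n₁ : Fin N → K}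
    (hn₀ : n₀ ∈ M) (hn₁ : n₁ ∈ M) (hx₀ : B₀ σ N x n₀ = 0) (hx₁ : B₀ σ N x n₁ = 0)
    (h₀₀ : Valued.v (B₀ σ N n₀ n₀) ≤ Valued.v ϖ ^ 2) (h₀₁ : B₀ σ N n₀ n₁ = ϖ) (h₁₁ : Valued.v (B₀ σ N n₁ n₁) ≤ Valued.v ϖ) :
    ∃ f₀ f₂ : Fin N → K, f₀ ∈ M ∧ f₂ ∈ M ∧ B₀ σ N f₀ f₀ = 0 ∧ B₀ σ N f₂ f₂ = 0 ∧ B₀ σ N f₀ f₂ = ϖ ∧ B₀ σ N x f₀ = 0 ∧ B₀ σ N x f₂ = 0 := by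
  have hϖ0 : ϖ ≠ 0 := uniformizer_ne_zero hd.vϖ
  have hvϖ0 : Valued.v ϖ ≠ 0 := (Valuation.ne_zero_iff Valued.v).2 hϖ0
  have hϖ1 : Valued.v ϖ < 1 := by rw [hd.vϖ, ← WithZero.exp_zero, WithZero.exp_lt_exp]; omega
  have herm : ∀ y z : Fin N → K, B₀ σ N z y = σ (B₀ σ N y z) := fun y z => (isHermitianForm_B₀ hd.σσ y z).symm
  obtain ⟨t, ht1, htt⟩ := hd.trace
  -- `c = h(n₀,n₀)/ϖ ∈ 𝔪` and `q = h(n₁,n₁)/ϖ ∈ 𝒪`, both `σ`-fixed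
  obtain ⟨c, hB₀₀, hσc, hvc⟩ : ∃ c : K, B₀ σ N n₀ n₀ = ϖ * c ∧ σ c = c ∧ Valued.v c < 1 := by
    refine ⟨B₀ σ N n₀ n₀ / ϖ, by field_simp, by rw [map_div₀, hd.σϖ, isHermitianForm_B₀ hd.σσ n₀ n₀], ?_⟩
    rw [map_div₀, div_lt_iff₀ (zero_lt_iff.2 hvϖ0), one_mul]
    calc Valued.v (B₀ σ N n₀ n₀) ≤ Valued.v ϖ ^ 2 := h₀₀
      _ < Valued.v ϖ := by rw [pow_two]; exact mul_lt_of_lt_one_left (zero_lt_iff.2 hvϖ0) hϖ1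
  obtain ⟨q, hB₁₁, hσq, hvq⟩ : ∃ q : K, B₀ σ N n₁ n₁ = ϖ * q ∧ σ q = q ∧ Valued.v q ≤ 1 := by
    refine ⟨B₀ σ N n₁ n₁ / ϖ, by field_simp, by rw [map_div₀, hd.σϖ, isHermitianForm_B₀ hd.σσ n₁ n₁], ?_⟩
    rw [map_div₀]; exact div_le_one_of_le₀ h₁₁ zero_le
  obtain ⟨α, hαv, hαeq⟩ := hd.exists_isotropic_coeff hσc hσq hvq hvc
  have hα1 : Valued.v α ≤ 1 := hαv.trans hvc.le
  have h₁₀ : B₀ σ N n₁ n₀ = ϖ := by rw [herm, h₀₁, hd.σϖ]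
  -- the exactly isotropic `f₀ = n₀ + α n₁`
  set f₀ : Fin N → K := n₀ + α • n₁ with hf₀
  have hf₀M : f₀ ∈ M := M.add_mem hn₀ (smul_mem_of_v_le _ hα1 hn₁)
  have hxf₀ : B₀ σ N x f₀ = 0 := by rw [hf₀, map_add, form_smul_right, hx₀, hx₁, mul_zero, add_zero]
  have hf₀f₀ : B₀ σ N f₀ f₀ = 0 := by
    have h : B₀ σ N f₀ f₀ = ϖ * (c + α + σ α + q * (α * σ α)) := by
      simp only [hf₀, map_add, LinearMap.add_apply, form_smul_left, form_smul_right, h₀₁, h₁₀, hB₀₀, hB₁₁]; ring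
    rw [h, hαeq, mul_zero]
  -- the partner `g₂ = w⁻¹ n₁`, `h(f₀, g₂) = ϖ`
  have hf₀n₁ : B₀ σ N f₀ n₁ = ϖ * (1 + σ α * q) := by
    simp only [hf₀, map_add, LinearMap.add_apply, form_smul_left, h₀₁, hB₁₁]; ring
  have hw : Valued.v (1 + σ α * q) = 1 := by
    refine Valuation.map_one_add_of_lt _ ?_
    rw [map_mul, hd.vσ]
    calc Valued.v α * Valued.v q ≤ Valued.v c * 1 := mul_le_mul' hαv hvq
      _ < 1 := by rw [mul_one]; exact hvc
  have hw0 : (1 + σ α * q) ≠ 0 := fun h => by rw [h, map_zero] at hw; exact zero_ne_one hw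
  set g₂ : Fin N → K := (1 + σ α * q)⁻¹ • n₁ with hg₂
  have hg₂M : g₂ ∈ M := smul_mem_of_v_le _ (by rw [map_inv₀, hw, inv_one]) hn₁
  have hxg₂ : B₀ σ N x g₂ = 0 := by rw [hg₂, form_smul_right, hx₁, mul_zero]
  have hf₀g₂ : B₀ σ N f₀ g₂ = ϖ := by rw [hg₂, form_smul_right, hf₀n₁]; field_simp
  have hg₂f₀ : B₀ σ N g₂ f₀ = ϖ := by rw [herm, hf₀g₂, hd.σϖ]
  -- `ρ' = h(g₂,g₂)/ϖ ∈ 𝒪`, `σ`-fixed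
  obtain ⟨ρ', hρ', hσρ', hvρ'⟩ : ∃ ρ' : K, B₀ σ N g₂ g₂ = ϖ * ρ' ∧ σ ρ' = ρ' ∧ Valued.v ρ' ≤ 1 := by
    refine ⟨B₀ σ N g₂ g₂ / ϖ, by field_simp, by rw [map_div₀, hd.σϖ, isHermitianForm_B₀ hd.σσ g₂ g₂], ?_⟩
    rw [map_div₀]
    refine div_le_one_of_le₀ ?_ zero_le
    rw [hg₂, form_smul_left, form_smul_right, map_mul, map_mul, hd.vσ, map_inv₀, hw, inv_one, one_mul, one_mul]
    exact h₁₁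
  -- `f₂ = g₂ + ν f₀`, `ν = −t ρ'`
  set ν : K := -(t * ρ') with hν
  have hvν : Valued.v ν ≤ 1 := by rw [hν, Valuation.map_neg, map_mul]; exact mul_le_one' ht1 hvρ'
  have hσν : σ ν = -(σ t * ρ') := by rw [hν, map_neg, map_mul, hσρ']
  set f₂ : Fin N → K := g₂ + ν • f₀ with hf₂
  have hf₂M : f₂ ∈ M := M.add_mem hg₂M (smul_mem_of_v_le _ hvν hf₀M)
  have hxf₂ : B₀ σ N x f₂ = 0 := by rw [hf₂, map_add, hxg₂, form_smul_right, hxf₀, mul_zero, add_zero]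
  have hf₂f₂ : B₀ σ N f₂ f₂ = 0 := by
    have h : B₀ σ N f₂ f₂ = ϖ * ρ' + ν * ϖ + σ ν * ϖ := by
      simp only [hf₂, map_add, LinearMap.add_apply, form_smul_left, form_smul_right, hg₂f₀, hf₀g₂, hf₀f₀, hρ']; ring
    rw [h, hσν, hν]
    linear_combination (-(ϖ * ρ')) * htt
  have hf₀f₂ : B₀ σ N f₀ f₂ = ϖ := by rw [hf₂, map_add, hf₀g₂, form_smul_right, hf₀f₀, mul_zero, add_zero]
  exact ⟨f₀, f₂, hf₀M, hf₂M, hf₀f₀, hf₂f₂, hf₀f₂, hxf₀, hxf₂⟩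

/-! ## §36 The adapted vectors of a type-two vertex -/

/-- **ADAPTED VECTORS OF A TYPE-TWO VERTEX.**  Every type-two vertex lattice `M` of `(K³, J₀)` (unramified datum) contains vectors `x, f₀, f₂` with `|h(x,x)| = 1`, `x ⊥ f₀, f₂`,
`h(f₀,f₀) = h(f₂,f₂) = 0`, `h(f₀,f₂) = ϖ` — the Jordan splitting `⟨ε⟩ ⊥ ϖ·Hyp` realised INSIDE `M` (FILE 1 orthogonal basis + §34 with the isotropic `e₀` + §35).
[cite: Jacobowitz1962, §4, §7] [cite: Omeara1963, §82F, §93] -/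
theorem exists_adapted_vectors_of_isVertexLattice_two (hd : UnramifiedLocalConjDatum σ ϖ) {M : Submodule 𝒪[K] (Fin 3 → K)}
    (hM : IsVertexLattice σ ϖ ((StdForm.antidiagonal 3).over K) 2 M) :
    ∃ x f₀ f₂ : Fin 3 → K, x ∈ M ∧ f₀ ∈ M ∧ f₂ ∈ M ∧ Valued.v (B₀ σ 3 x x) = 1 ∧ B₀ σ 3 x f₀ = 0 ∧ B₀ σ 3 x f₂ = 0 ∧
      B₀ σ 3 f₀ f₀ = 0 ∧ B₀ σ 3 f₂ f₂ = 0 ∧ B₀ σ 3 f₀ f₂ = ϖ := by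
  obtain ⟨g, rfl, hx, h01, h02⟩ := exists_orthogonal_basis hd hM
  obtain ⟨hblk, hdet⟩ := typeTwo_block hd hM hx h01 h02
  have hiso : B₀ σ 3 (Pi.single 0 1 : Fin 3 → K) (Pi.single 0 1) = 0 := by rw [B₀_single_left]; rfl
  have he0 : (Pi.single 0 1 : Fin 3 → K) ≠ 0 := by
    intro h
    have h0 := congrFun h 0
    rw [Pi.single_eq_same, Pi.zero_apply] at h0
    exact one_ne_zero h0
  obtain ⟨n₀, n₁, hn₀, hn₁, hxn₀, hxn₁, h₀₀, h₀₁, h₁₁⟩ := exists_near_hyperbolic_pair hd (latt (g : Matrix (Fin 3) (Fin 3) K))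
    (mulVec_single_mem_latt _ 1) (mulVec_single_mem_latt _ 2) hx h01 h02 (hblk 1 1 (by decide) (by decide)) (hblk 1 2 (by decide) (by decide))
    (hblk 2 1 (by decide) (by decide)) (hblk 2 2 (by decide) (by decide)) hdet hiso he0 (eq_coords_three g (Pi.single 0 1))
  obtain ⟨f₀, f₂, hf₀, hf₂, hf₀f₀, hf₂f₂, hf₀f₂, hxf₀, hxf₂⟩ :=
    exists_hyperbolic_pair_of_near_pair hd (latt (g : Matrix (Fin 3) (Fin 3) K)) hn₀ hn₁ hxn₀ hxn₁ h₀₀ h₀₁ h₁₁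
  exact ⟨_, f₀, f₂, mulVec_single_mem_latt _ 0, hf₀, hf₂, hx, hxf₀, hxf₂, hf₀f₀, hf₂f₂, hf₀f₂⟩

end Literature.NumberTheory.Automorphic.UnitaryLatticeTree

end
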